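import Summits.Ventures.MM22.Rank333.ProfileCertRules
import Mathlib.Algebra.BigOperators.Ring.Finset
import Mathlib.Algebra.Order.BigOperators.Group.Finset
import HarnessLib

/-!
# MM22 venture — PROFILE-CERT kernel replay: propagation step lists, node semantics, the C8 integer LP dual

HONEST FRAMING (cell `pub-mm22`, seat p1 g5; V4-MENU item (0′) «kernel replay of the whole-root PROFILE-CERT»).
Checker PLUMBING with soundness theorems, written from the FROZEN format specification
`HOME/pub-mm22-p2/pcert/PROFILE-CERT-v1-frozen-20260822T2120Z.md` (sha256 59fc6c87…) only. The end declaration of the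
chain (`ProfileCertGlue.rankGe21F2_of_pieces`) is an IMPLICATION whose antecedents are Wang's `Cert 3 3 3 [] 20`, a
certified orbit table (Wang's printed values and the cell's 8 LP/LPDFS lifts), a passing singleton check and the
`NoExt` statement that the (not yet landed) data files assemble to. NOTHING here proves a bound on `R_𝔽₂(⟨3,3,3⟩)`;
no summit claim.

This file: `stepRun_sound`/`stepsRun_sound`, `Sem`/`ChainNoExt`/`PC.noS`/`PC.maps`, and the soundness of C8.
-/

set_option autoImplicit false

namespace Summit.Ventures.MM22.ProfileCert

section Steps0
open Finset
variable {rt : RT} {N : ℕ} {V : Finset ℕ → Prop}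
/-! ## steps -/

section Steps
variable (hV : VHyp0 rt N V)
include hV

/-- One step: the new state is well formed and every valid extension of the old state extends it. -/
theorem stepRun_sound {st : Step} {s s' : St} (hW : s.WF) (h : stepRun rt N st s = some s') :
    s'.WF ∧ ∀ M, V M → s.Ext M → s'.Ext M := by
  cases st with
  | pm f rid =>
    simp only [stepRun] at h
    split_ifs at h with hc
    cases h
    simp only [Bool.and_eq_true, decide_eq_true_eq] at hc
    exact ⟨hW.setOut hc.1.2, fun M hM hE => hE.setOut_of_not_mem (forced_out hV hW hc.1.1 hc.1.2 hc.2 hM hE)⟩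
  | pp f rid =>
    simp only [stepRun] at h
    split_ifs at h with hc
    cases h
    simp only [Bool.and_eq_true, Bool.not_eq_true', decide_eq_true_eq] at hc
    exact ⟨hW.setIn hc.1.2, fun M hM hE => hE.setIn_of_mem (forced_in hV hW hc.1.1 hc.1.2 hc.2 hM hE)⟩
  | pmN f =>
    simp only [stepRun] at h
    split_ifs at h with hc
    cases h
    simp only [Bool.and_eq_true, decide_eq_true_eq] at hc
    exact ⟨hW.setOut hc.1, fun M hM hE => hE.setOut_of_not_mem (forced_out_N hV hW hc.1 hc.2 hM hE)⟩
  | ppN f =>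
    simp only [stepRun] at h
    split_ifs at h with hc
    cases h
    simp only [Bool.and_eq_true, decide_eq_true_eq] at hc
    exact ⟨hW.setIn hc.1, fun M hM hE => hE.setIn_of_mem (forced_in_N hV hW hc.1 hc.2 hM hE)⟩

/-- A list of steps: well-formedness and extension transfer. -/
theorem stepsRun_sound : ∀ {ss : List Step} {s s' : St}, s.WF → stepsRun rt N ss s = some s' →
    s'.WF ∧ ∀ M, V M → s.Ext M → s'.Ext M
  | [], s, s', hW, h => by
    simp only [stepsRun, Option.some.injEq] at h
    subst h; exact ⟨hW, fun _ _ hE => hE⟩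
  | st :: ss, s, s', hW, h => by
    simp only [stepsRun] at h
    split at h
    · cases h
    · rename_i s₁ hs₁
      obtain ⟨hW₁, hE₁⟩ := stepRun_sound hV hW hs₁
      obtain ⟨hW', hE'⟩ := stepsRun_sound hW₁ h
      exact ⟨hW', fun M hM hE => hE' M hM (hE₁ M hM hE)⟩

end Steps

/-! ## semantics of nodes and the main induction -/

/-- What a passing node means: `NoExt` for ordinary nodes; for chain nodes, the kids' statements. -/
def Sem (V : Finset ℕ → Prop) : PC → St → Prop
  | .scons o _ rest, s => (∀ x₀, o.head? = some x₀ → s.free x₀ = true → NoExt V (s.setIn x₀)) ∧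
      ((∀ f ∈ o, s.free f = true) → o.Nodup → Sem V rest (s.setOutL o))
  | .slast _, s => NoExt V s
  | .c1 _, s => NoExt V s
  | .c3 _, s => NoExt V s
  | .c4, s => NoExt V s
  | .c8 _ _, s => NoExt V s
  | .seq _ _, s => NoExt V s
  | .b _ _ _, s => NoExt V s
  | .s _ _, s => NoExt V s
  | .ref _, s => NoExt V s

/-- For ordinary nodes `Sem` is `NoExt`. -/
theorem sem_iff_of_not_chain {t : PC} (ht : t.isChain = false) (s : St) : Sem V t s ↔ NoExt V s := by
  cases t <;> first | rfl | simp [PC.isChain] at ht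

/-- Unrolled chain statement along the orbits. -/
def ChainNoExt (V : Finset ℕ → Prop) : List (List ℕ) → St → Prop
  | [], s => NoExt V s
  | o :: os, s => (∀ x₀, o.head? = some x₀ → NoExt V (s.setIn x₀)) ∧ ChainNoExt V os (s.setOutL o)

/-- The certificate tree has no S-node (then no symmetry hypothesis is needed). -/
def PC.noS : PC → Bool
  | .seq _ t => t.noS
  | .b _ tin tout => tin.noS && tout.noS
  | .s _ _ => false
  | .scons _ kid rest => kid.noS && rest.noS
  | .slast kid => kid.noS
  | _ => true


/-- The generators used by the S-nodes of a certificate tree (chunk references excluded: they carry their own). -/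
def PC.maps : PC → List MapW
  | .seq _ t => t.maps
  | .b _ tin tout => tin.maps ++ tout.maps
  | .s ms body => ms ++ body.maps
  | .scons _ kid rest => kid.maps ++ rest.maps
  | .slast kid => kid.maps
  | _ => []

/-- A tree without S-nodes uses no generators. -/
theorem PC.maps_eq_nil_of_noS : ∀ t : PC, t.noS = true → t.maps = []
  | .seq _ t, h => PC.maps_eq_nil_of_noS t (by simpa [PC.noS] using h)
  | .b _ tin tout, h => by
    simp only [PC.noS, Bool.and_eq_true] at h
    simp [PC.maps, PC.maps_eq_nil_of_noS tin h.1, PC.maps_eq_nil_of_noS tout h.2]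
  | .s _ _, h => by simp [PC.noS] at h
  | .scons _ kid rest, h => by
    simp only [PC.noS, Bool.and_eq_true] at h
    simp [PC.maps, PC.maps_eq_nil_of_noS kid h.1, PC.maps_eq_nil_of_noS rest h.2]
  | .slast kid, h => PC.maps_eq_nil_of_noS kid (by simpa [PC.noS] using h)
  | .c1 _, _ => rfl
  | .c3 _, _ => rfl
  | .c4, _ => rfl
  | .c8 _ _, _ => rfl
  | .ref _, _ => rfl

/-- C8 soundness (the integer LP dual bound). -/
theorem sound_c8 (hV : VHyp0 rt N V) {s : St} (hW : s.WF) {D : ℕ} {ys : List (ℕ × ℕ)}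
    (h : c8OK rt N s D ys = true) : NoExt V s := by
  classical
  intro M hM hE
  -- unpack the Boolean premise
  simp only [c8OK, Bool.and_eq_true, decide_eq_true_eq, List.all_eq_true] at h
  obtain ⟨hslack, hD, hlt⟩ := h
  set rows : List (Row × ℕ) := ys.map fun (ry : ℕ × ℕ) => (rt.get ry.1, ry.2) with hrows
  -- abbreviations
  let U : Row → Finset ℕ → Finset ℕ := fun r X => X.filter fun f => r.mask.testBit f = true
  let MF : Finset ℕ := M.filter fun f => f ∈ s.freeSet           -- M ∩ FREE
  let Sf : ℕ → ℕ := fun f => (rows.map fun (r : Row × ℕ) => if r.1.mask.testBit f then r.2 else 0).sum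
  -- (1) |M| = nIn + |M ∩ FREE|
  have hMsplit : M.card = s.nIn + MF.card := by
    have hsub := ext_subset_union hV hM hE
    have h1 : M.filter (fun f => f ∈ s.inSet) = s.inSet := by
      ext f; simp only [Finset.mem_filter]
      exact ⟨fun h => h.2, fun h => ⟨hE.inSet_subset h, h⟩⟩
    have h2 : M.filter (fun f => ¬ f ∈ s.inSet) = MF := by
      ext f; simp only [Finset.mem_filter, MF]
      constructor
      · rintro ⟨hf, hni⟩
        rcases Finset.mem_union.1 (hsub hf) with h | h
        · exact absurd h hni
        · exact ⟨hf, h⟩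
      · rintro ⟨hf, hfr⟩
        refine ⟨hf, fun hi => ?_⟩
        exact (St.mem_freeSet.1 hfr).2.1 (List.mem_toFinset.1 hi)
    have := Finset.card_filter_add_card_filter_not (s := M) (fun f => f ∈ s.inSet)
    rw [h1, h2, St.inSet_card hW] at this
    omega
  -- (2) every row: |MF ∩ U_i| ≤ cap_i − inU_i
  have hrow : ∀ r ∈ rows, (U r.1 MF).card + s.inU r.1 ≤ r.1.cap := by
    intro r hr
    obtain ⟨ry, hry, rfl⟩ := List.mem_map.1 hr
    have hdisj : Disjoint (U (rt.get ry.1) MF) (U (rt.get ry.1) s.inSet) := by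
      rw [Finset.disjoint_left]
      intro f hf hf'
      simp only [U, MF, Finset.mem_filter] at hf hf'
      exact (St.mem_freeSet.1 hf.1.2).2.1 (List.mem_toFinset.1 hf'.1)
    have hsub : U (rt.get ry.1) MF ∪ U (rt.get ry.1) s.inSet ⊆ U (rt.get ry.1) M := by
      intro f hf
      simp only [U, MF, Finset.mem_union, Finset.mem_filter] at hf ⊢
      rcases hf with ⟨⟨hfM, _⟩, hU⟩ | ⟨hfi, hU⟩
      · exact ⟨hfM, hU⟩
      · exact ⟨hE.inSet_subset hfi, hU⟩
    have := Finset.card_le_card hsub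
    rw [Finset.card_union_of_disjoint hdisj, ← St.inU_eq hW] at this
    exact this.trans (hV.rows M hM ry.1)
  -- (3) D·|MF| ≤ Σ_{f ∈ MF} S_f + Σ_{f ∈ MF} (D − S_f)
  have h3 : D * MF.card ≤ (∑ f ∈ MF, Sf f) + ∑ f ∈ MF, (D - Sf f) := by
    rw [← Finset.sum_add_distrib, Finset.card_eq_sum_ones, Finset.mul_sum]
    exact Finset.sum_le_sum fun f _ => by omega
  -- (4) Σ_{f ∈ MF} S_f = Σ_rows y_i · |MF ∩ U_i| ≤ Σ_rows y_i · (cap_i − inU_i) = b1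
  have h4 : (∑ f ∈ MF, Sf f) ≤ (rows.map fun (r : Row × ℕ) => r.2 * (r.1.cap - s.inU r.1)).sum := by
    have hswap : (∑ f ∈ MF, Sf f) = (rows.map fun (r : Row × ℕ) => r.2 * (U r.1 MF).card).sum := by
      simp only [Sf]
      induction rows with
      | nil => simp
      | cons r rs ih =>
        simp only [List.map_cons, List.sum_cons]
        rw [Finset.sum_add_distrib, ih]
        congr 1
        rw [show (U r.1 MF).card = ∑ f ∈ MF, (if r.1.mask.testBit f = true then 1 else 0) from
          Finset.card_filter _ _, Finset.mul_sum]
        refine Finset.sum_congr rfl fun f _ => ?_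
        by_cases hb : r.1.mask.testBit f = true <;> simp [hb]
    rw [hswap]
    -- termwise comparison along the list
    have : ∀ (l : List (Row × ℕ)), (∀ r ∈ l, (U r.1 MF).card + s.inU r.1 ≤ r.1.cap) →
        (l.map fun (r : Row × ℕ) => r.2 * (U r.1 MF).card).sum ≤
        (l.map fun (r : Row × ℕ) => r.2 * (r.1.cap - s.inU r.1)).sum := by
      intro l
      induction l with
      | nil => intro _; simp
      | cons r rs ih =>
        intro hl
        simp only [List.map_cons, List.sum_cons]
        have h1 := hl r (by simp)
        have h2 := ih fun r' hr' => hl r' (List.mem_cons_of_mem r hr')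
        have : r.2 * (U r.1 MF).card ≤ r.2 * (r.1.cap - s.inU r.1) := Nat.mul_le_mul_left _ (by omega)
        omega
    exact this rows hrow
  -- (5) Σ_{f ∈ MF} (D − S_f) ≤ Σ_{f ∈ FREE} (D − S_f) = b2
  have h5 : (∑ f ∈ MF, (D - Sf f)) ≤ sumUpTo (fun f => if s.freeMask.testBit f then D - Sf f else 0) NF := by
    rw [sumUpTo_NF]
    have hMF : MF ⊆ forms := fun f hf => (St.mem_freeSet.1 (Finset.mem_filter.1 hf).2).1
    calc (∑ f ∈ MF, (D - Sf f)) = ∑ f ∈ MF, (if s.freeMask.testBit f then D - Sf f else 0) := by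
          refine Finset.sum_congr rfl fun f hf => ?_
          rw [if_pos ((St.testBit_freeMask hW f).2 (Finset.mem_filter.1 hf).2)]
      _ ≤ ∑ f ∈ forms, (if s.freeMask.testBit f then D - Sf f else 0) :=
          Finset.sum_le_sum_of_subset_of_nonneg hMF fun _ _ _ => Nat.zero_le _
  -- (6) combine
  have hcard := hV.card M hM
  have hb := h3.trans (Nat.add_le_add h4 h5)
  have : M.card * D < N * D := by
    rw [hMsplit, Nat.add_mul, Nat.mul_comm MF.card D]
    calc s.nIn * D + D * MF.card
        ≤ s.nIn * D + ((rows.map fun (r : Row × ℕ) => r.2 * (r.1.cap - s.inU r.1)).sum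
            + sumUpTo (fun f => if s.freeMask.testBit f then D - Sf f else 0) NF) := Nat.add_le_add_left hb _
      _ = s.nIn * D + (rows.map fun (r : Row × ℕ) => r.2 * (r.1.cap - s.inU r.1)).sum
            + sumUpTo (fun f => if s.freeMask.testBit f then D - Sf f else 0) NF := (Nat.add_assoc _ _ _).symm
      _ < N * D := hlt
  rw [hcard] at this
  exact lt_irrefl _ this


end Steps0

end Summit.Ventures.MM22.ProfileCert
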